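import Literature.Probability.RandomPlanarGeometry.HexSAWRotSurfaceYcLimitAllY
import Literature.Probability.RandomPlanarGeometry.HexSAWArmchairWallRateSqrtMonotone
import HarnessLib

/-!
# The shape of Beaton's `μ(y)` in the rotated frame: constant `= μ` on `(0, y†]`, STRICTLY increasing on `[y†, ∞)`,
# and the envelope `√y < μ(y) ≤ μ √(y/y†)` for `y ≥ y†`

Topic `Literature/Probability/RandomPlanarGeometry` (lane «pcv-sawmu», rotated-door lineage; a rider on the door
`HexSAWRotSurfaceYcLimitAllY.lean` — `HV.rotSurfaceMu_eq_iff : μ_rot(y) = μ ↔ y ≤ y†`, `hexConnectiveConstant_lt_armRate_iff : μ < β_rot(y) ↔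
y† < y` — combined with `HexSAWArmchairWallRateSqrtMonotone.lean` — `Arm.convexOn_log_armRate_exp`, `HV.rotSurfaceMu_le_sqrt_div_mul` — and
`HexSAWArmchairSqrtStrict.lean` — `Arm.sqrt_lt_armRate`, reached through the former's imports).

Sources.  N. R. Beaton, J. Phys. A 47 (2014) 075003 = arXiv:1210.0274v3, §3.1, Proposition 7 (p. 11: "For `0 < y ≤ 1`,
`μ(y) = μ(1) = μ`, where `μ = √(2+√2)` is the growth constant of SAWs on the honeycomb lattice. Moreover, for any `y > 0`, `μ(y) ≥ max{μ, √y}`. This implies the existence of a critical value `y_c`, with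
`1 ≤ y_c ≤ μ²`, which delineates the transition from the desorbed phase to the adsorbed phase: `μ(y) = μ` if `y ≤ y_c`, `> μ` if
`y > y_c`"; "It is a log-convex, non-decreasing function of `log y`"), Theorem 1 (p. 2: `y_c = y† = 2.455…`).  J. M. Hammersley,
G. M. Torrie, S. G. Whittington, J. Phys. A 15 (1982) 539, §2.

What is proved (namespaces `…SAW.HexBW.Arm` / `…SAW.HV`; no hypotheses beyond `0 < y`):

* `Arm.armRate_le_hexConnectiveConstant_iff (0 < y) : β_rot(y) ≤ μ ↔ y ≤ y†`, `armRate_rotYdagger_le : β_rot(y†) ≤ μ`;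
* **`Arm.strictMonoOn_armRate : StrictMonoOn armRate (Set.Ici y†)`** and **`HV.strictMonoOn_rotSurfaceMu : StrictMonoOn rotSurfaceMu
  (Set.Ici y†)`** — in the adsorbed regime Beaton's `μ(y)` is STRICTLY increasing (print: "non-decreasing"; strictness is the standard
  consequence of log-convexity once `μ(y) > μ(y†)` for `y > y†`), `HV.rotSurfaceMu_lt_rotSurfaceMu_iff_of_le` (for `y† ≤ y, y'`:
  `μ_rot(y) < μ_rot(y') ↔ y < y'`), `HV.rotSurfaceMu_injOn : Set.InjOn rotSurfaceMu (Set.Ici y†)`;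
* the envelope above `y†`: **`HV.rotSurfaceMu_le_mul_sqrt_div (y† ≤ y) : μ_rot(y) ≤ μ · √(y/y†)`**, `Arm.armRate_le_mul_sqrt_div`,
  `HV.rotSurfaceMu_div_sqrt_mem_Ioc (y† ≤ y) : μ_rot(y)/√y ∈ (1, μ/√y†]` (lower end from `Arm.sqrt_lt_armRate` of `HexSAWArmchairSqrtStrict`);

Status in print / LABEL (author's proposal): strict monotonicity above `y_c` and the explicit envelope
`μ(y) ≤ μ √(y/y_c)` are elementary consequences of the printed log-convexity, of `μ(y_c) = μ` and of the
order `√y` at infinity which we have not found stated — lane corollaries, NEW-IN-WRITING (XS) at most.  (The envelope was suggested by a-p5 g12 as the armchair mirror of its zig-zag «SURFACE-MU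
SQRT-ENVELOPE».)
EDITIONS: ed.4b 32e758f0cd34d184 (a-p6 g12; custody a-idea-2 g27 07:40:41Z, label lit-1 g18 07:37:44Z; imported `HexSAWRotSurfaceSqrtUpper`
for the single lemma `sqrt_lt_rotSurfaceMu`); ed.5 (this, a-p6 g13) = ed.4b with that import REMOVED and the one use replaced by
`(sqrt_lt_armRate hy).trans_le (armRate_le_rotSurfaceMu y)` (N's strict bound, available through `HexSAWArmchairWallRateSqrtMonotone`'s
imports) — one proof line and two docstring phrases changed, every statement byte-identical; the module no longer waits on G's olean.
-/

noncomputable section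

open Finset Filter Function
open Literature.Probability.LatticeModels Literature.Probability.Percolation SimpleGraph
open _root_.Topology

namespace Literature.Probability.RandomPlanarGeometry.SAW.HexBW.Arm

open HV

variable {y : ℝ}

/-- **`β_rot(y) ≤ μ ↔ y ≤ y†`.** [cite: Beaton2014RotatedHoneycomb, Proposition 7 (arXiv v3 p. 11: "μ(y) = μ if y ≤ y_c, > μ if y > y_c"), Theorem 1 (p. 2)] -/
theorem armRate_le_hexConnectiveConstant_iff (hy : 0 < y) : armRate y ≤ hexConnectiveConstant ↔ y ≤ rotYdagger := by
  rw [← not_lt, hexConnectiveConstant_lt_armRate_iff hy, not_lt]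

/-- `β_rot(y†) ≤ μ`. [cite: Beaton2014RotatedHoneycomb, Proposition 7 (arXiv v3 p. 11), Theorem 1 (p. 2)] -/
theorem armRate_rotYdagger_le : armRate rotYdagger ≤ hexConnectiveConstant :=
  (armRate_le_hexConnectiveConstant_iff rotYdagger_pos).2 le_rfl

/-- **`β_rot` is STRICTLY increasing on `[y†, ∞)`**: a log-convex function of `log y` which exceeds its value at `y†` to the right of `y†`.
[cite: Beaton2014RotatedHoneycomb, Proposition 7 (arXiv v3 p. 11: "log-convex, non-decreasing"; "> μ if y > y_c"); HammersleyTorrieWhittington1982, §2] -/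
theorem strictMonoOn_armRate : StrictMonoOn armRate (Set.Ici rotYdagger) := by
  intro y₁ hy₁ y₂ _ h12
  have hyd := rotYdagger_pos
  have hy₁' : rotYdagger ≤ y₁ := hy₁
  have h1 : 0 < y₁ := hyd.trans_le hy₁'
  have h2 : 0 < y₂ := h1.trans h12
  have hμ2 : hexConnectiveConstant < armRate y₂ := (hexConnectiveConstant_lt_armRate_iff h2).2 (lt_of_le_of_lt hy₁' h12)
  rcases hy₁'.eq_or_lt with h | h
  · rw [← h]; exact armRate_rotYdagger_le.trans_lt hμ2
  · -- `t† < t₁ < t₂`: the slope of `[t†, t₁]` is positive, and `≤` the slope of `[t₁, t₂]`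
    set f : ℝ → ℝ := fun t => Real.log (armRate (Real.exp t)) with hf
    have hμ1 : hexConnectiveConstant < armRate y₁ := (hexConnectiveConstant_lt_armRate_iff h1).2 h
    have ht1 : Real.log rotYdagger < Real.log y₁ := Real.log_lt_log hyd h
    have ht2 : Real.log y₁ < Real.log y₂ := Real.log_lt_log h1 h12
    have hslope := convexOn_log_armRate_exp.slope_mono_adjacent (Set.mem_univ (Real.log rotYdagger)) (Set.mem_univ (Real.log y₂)) ht1 ht2
    simp only [Real.exp_log hyd, Real.exp_log h1, Real.exp_log h2] at hslope
    have hnum : 0 < Real.log (armRate y₁) - Real.log (armRate rotYdagger) :=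
      sub_pos.2 (Real.log_lt_log (armRate_pos _) (armRate_rotYdagger_le.trans_lt hμ1))
    have hlhs : 0 < (Real.log (armRate y₁) - Real.log (armRate rotYdagger)) / (Real.log y₁ - Real.log rotYdagger) :=
      div_pos hnum (sub_pos.2 ht1)
    have hrhs : 0 < (Real.log (armRate y₂) - Real.log (armRate y₁)) / (Real.log y₂ - Real.log y₁) := hlhs.trans_le hslope
    have hnum2 : 0 < Real.log (armRate y₂) - Real.log (armRate y₁) := by
      by_contra hcon
      have : (Real.log (armRate y₂) - Real.log (armRate y₁)) / (Real.log y₂ - Real.log y₁) ≤ 0 :=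
        div_nonpos_of_nonpos_of_nonneg (not_lt.1 hcon) (sub_pos.2 ht2).le
      linarith
    exact (Real.log_lt_log_iff (armRate_pos _) (armRate_pos _)).1 (sub_pos.1 hnum2)

/-- **`β_rot(y) ≤ μ · √(y/y†)` for `y ≥ y†`** (the `½`-chord law from `y†`, where `β_rot ≤ μ`).
[cite: Beaton2014RotatedHoneycomb, Proposition 7 (arXiv v3 p. 11: log-convexity; "μ(y) = μ if y ≤ y_c")] -/
theorem armRate_le_mul_sqrt_div (h : rotYdagger ≤ y) : armRate y ≤ hexConnectiveConstant * Real.sqrt (y / rotYdagger) := by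
  have h1 := armRate_le_sqrt_div_mul rotYdagger_pos h
  calc armRate y ≤ Real.sqrt (y / rotYdagger) * armRate rotYdagger := h1
    _ ≤ Real.sqrt (y / rotYdagger) * hexConnectiveConstant := mul_le_mul_of_nonneg_left armRate_rotYdagger_le (Real.sqrt_nonneg _)
    _ = hexConnectiveConstant * Real.sqrt (y / rotYdagger) := mul_comm _ _

end Literature.Probability.RandomPlanarGeometry.SAW.HexBW.Arm

namespace Literature.Probability.RandomPlanarGeometry.SAW.HV

open HexBW.Arm

variable {y : ℝ}

/-- **Beaton's `μ(y)` is STRICTLY increasing on `[y†, ∞)`.**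
[cite: Beaton2014RotatedHoneycomb, Proposition 7 (arXiv v3 p. 11: "non-decreasing"; "μ(y) = μ if y ≤ y_c, > μ if y > y_c"); HammersleyTorrieWhittington1982, §2] -/
theorem strictMonoOn_rotSurfaceMu : StrictMonoOn rotSurfaceMu (Set.Ici rotYdagger) := by
  intro y₁ hy₁ y₂ hy₂ h12
  have hyd := rotYdagger_pos
  have hy₁' : rotYdagger ≤ y₁ := hy₁
  have h1 : 0 < y₁ := hyd.trans_le hy₁'
  have h2 : 0 < y₂ := h1.trans h12
  have hlt2 : rotYdagger < y₂ := lt_of_le_of_lt hy₁' h12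
  rw [rotSurfaceMu_eq_armRate h2 hlt2]
  rcases hy₁'.eq_or_lt with h | h
  · rw [← h, (rotSurfaceMu_eq_iff hyd).2 le_rfl]
    exact (hexConnectiveConstant_lt_armRate_iff h2).2 hlt2
  · rw [rotSurfaceMu_eq_armRate h1 h]
    exact strictMonoOn_armRate hy₁ hy₂ h12

/-- For `y† ≤ y, y'`: **`μ_rot(y) < μ_rot(y') ↔ y < y'`.** [cite: Beaton2014RotatedHoneycomb, Proposition 7 (arXiv v3 p. 11)] -/
theorem rotSurfaceMu_lt_rotSurfaceMu_iff_of_le (hy : rotYdagger ≤ y) {y' : ℝ} (hy' : rotYdagger ≤ y') :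
    rotSurfaceMu y < rotSurfaceMu y' ↔ y < y' :=
  strictMonoOn_rotSurfaceMu.lt_iff_lt hy hy'

/-- `μ_rot` is injective on `[y†, ∞)` (no plateau in the adsorbed regime). [cite: Beaton2014RotatedHoneycomb, Proposition 7 (arXiv v3 p. 11)] -/
theorem rotSurfaceMu_injOn : Set.InjOn rotSurfaceMu (Set.Ici rotYdagger) := strictMonoOn_rotSurfaceMu.injOn

/-- **The envelope `μ_rot(y) ≤ μ · √(y/y†)` for `y ≥ y†`.** [cite: Beaton2014RotatedHoneycomb, Proposition 7 (arXiv v3 p. 11: log-convexity; "μ(y) = μ if y ≤ y_c"); HammersleyTorrieWhittington1982, §2] -/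
theorem rotSurfaceMu_le_mul_sqrt_div (h : rotYdagger ≤ y) : rotSurfaceMu y ≤ hexConnectiveConstant * Real.sqrt (y / rotYdagger) := by
  have h1 := rotSurfaceMu_le_sqrt_div_mul rotYdagger_pos h
  rw [(rotSurfaceMu_eq_iff rotYdagger_pos).2 le_rfl] at h1
  rw [mul_comm]; exact h1

/-- **`μ_rot(y)/√y ∈ (1, μ/√y†]` for `y ≥ y†`.** [cite: Beaton2014RotatedHoneycomb, Proposition 7 (arXiv v3 p. 11)] -/
theorem rotSurfaceMu_div_sqrt_mem_Ioc (h : rotYdagger ≤ y) :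
    rotSurfaceMu y / Real.sqrt y ∈ Set.Ioc 1 (hexConnectiveConstant / Real.sqrt rotYdagger) := by
  have hyd := rotYdagger_pos
  have hy : 0 < y := hyd.trans_le h
  have hs : 0 < Real.sqrt y := Real.sqrt_pos.2 hy
  refine ⟨(one_lt_div hs).2 ((sqrt_lt_armRate hy).trans_le (armRate_le_rotSurfaceMu y)), ?_⟩
  rw [div_le_iff₀ hs]
  calc rotSurfaceMu y ≤ hexConnectiveConstant * Real.sqrt (y / rotYdagger) := rotSurfaceMu_le_mul_sqrt_div h
    _ = hexConnectiveConstant / Real.sqrt rotYdagger * Real.sqrt y := by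
        rw [Real.sqrt_div hy.le, div_mul_eq_mul_div, mul_div_assoc]

end Literature.Probability.RandomPlanarGeometry.SAW.HV
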